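import Summits.BirchSwinnertonDyer.BirchSwinnertonDyer.Theses.PrintX10b
import Literature.NumberTheory.EllipticCurves.NeronIsogenyScalingHoldsProofs
import HarnessLib

/-!
# Route PrintX10b — aside `NeronScalingIntegralOfMinimal` (stmt-BirchSwinnertonDyer-21209), PROVED by name

Cell `bsd-print-x9` (D-0131 (2) PRINT tier), seat `bsd-print-x9-p1` (prover p1, gen 3). The rev-3 aside
item-states the named fact `Literature.NumberTheory.EllipticCurves.integral_neronScaling_of_isGloballyMinimal`
(integrality of the Néron-differential scaling of a period-lattice comparison from a globally minimal model;
conjunct 12 = binder `hNS` of the Heegner print bundle `HeegnerPrintFactsX10b`), which the tree PROVES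
(`integral_neronScaling_of_isGloballyMinimal_holds`, `Literature/…/NeronIsogenyScalingHoldsProofs.lean`;
X9 twin: aside 20536, `Theorems/PrintX9NeronScalingIntegralOfMinimal.lean`, p543391). This file records the
discharge so the item closes BY NAME; no mathematics of its own. HONEST STATUS: closes one print aside of route
PrintX10b; no crux moves; BSD is not proved. beyond-print theorem: no.
[cite: SilvermanAEC2009, VII §1 and VIII §8]
-/

namespace Summit.BirchSwinnertonDyer.Rank1Residual.X10

/-- **Aside 21209 of route PrintX10b discharged**: `Theses.PrintX10b.NeronScalingIntegralOfMinimal` IS the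
proved tree theorem `integral_neronScaling_of_isGloballyMinimal_holds`.
[cite: SilvermanAEC2009, VII Prop. 1.3 (b) and VIII §8] -/
theorem printX10b_neronScalingIntegralOfMinimal_proof :
    Summit.BirchSwinnertonDyer.BirchSwinnertonDyer.Theses.PrintX10b.NeronScalingIntegralOfMinimal :=
  Literature.NumberTheory.EllipticCurves.integral_neronScaling_of_isGloballyMinimal_holds

end Summit.BirchSwinnertonDyer.Rank1Residual.X10
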